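import Literature.Analysis.Fourier.HilbertTransformCircleSeries
import Literature.Analysis.Fourier.TaylorOnClosedDisc
import Mathlib.Analysis.SpecificLimits.Normed
import Mathlib.Analysis.Normed.Module.Ball.Pointwise
import Mathlib.Topology.MetricSpace.Thickening
import Mathlib.MeasureTheory.Measure.Haar.Unique
import HarnessLib

/-!
# The periodic Hilbert transform of the boundary values of a holomorphic function

Topic `Literature/Analysis/Fourier`. For the p.v. operator `hilbertTransformCircle` of `HilbertTransformCircle.lean`
(`Hf(x) = (2π)⁻¹ ∫₀^π (f(x−t) − f(x+t)) cot(t/2) dt`, convention `H cos k· = sin k·`, `H sin k· = −cos k·`) we prove the classical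
description of the conjugate function of the real part of a holomorphic function:

* `hilbertTransformCircle_re_of_hasSum` — if `F(y) = Σ_{n ≥ 0} a_n e^{iny}` with a finite first moment `Σ n‖a_n‖ < ∞`, then
  `H[Re F](x) = Im F(x) − Im a₀` (complex-coefficient form of `hilbertTransformCircle_tsum`);
* `hilbertTransformCircle_re_eq_im` — if `g` is holomorphic on a neighbourhood of the closed unit disc, then for every `x`
  `H[y ↦ Re g(e^{iy})](x) = Im g(e^{ix}) − Im g(0)`: the conjugate function of `Re g|_{𝕋}` is `Im g|_{𝕋}` normalised to have
  mean zero (Taylor coefficients `TorusCoeff.taylorCoeff` of `TaylorOnClosedDisc.lean`, Cauchy's estimate for the first moment);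
* `hilbertTransformCircle_congr_ae` — the operator only sees `f` almost everywhere (translation invariance of Lebesgue measure).

These are the identities behind «conformally adapted» spectral discretisations of 1-D models on `𝕋` whose non-local term is `H`
(the change of variables by a disc automorphism is treated in `HilbertTransformCircleMoebius.lean`). Classical statements:
[cite: Katznelson2004, Ch. III §1 (the conjugate function; conjugate of `Re Σ a_n e^{int}` is `Im Σ a_n e^{int} − Im a₀`)],
[cite: Grafakos2014, Ex. 4.1.4(c)]. No definitions, no named facts.
-/

noncomputable section

namespace Literature.Analysis.Fourier

open _root_.MeasureTheory _root_.Complex Set Filter Metric TorusCoeff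
open scoped Real Topology NNReal

/-! ### The operator only depends on the a.e. class of `f` -/

/-- `hilbertTransformCircle f x` depends only on the almost-everywhere class of `f` (Lebesgue measure): the two symmetric
integrands agree a.e. in `t` because `t ↦ x − t` and `t ↦ x + t` preserve Lebesgue measure — the conjugate-function operator is a
(principal-value) convolution operator on `𝕋`, defined on a.e.-classes.
[cite: Grafakos2014, Ex. 4.1.4 (the conjugate function as the p.v. convolution with `cot(t/2)`)] -/
theorem hilbertTransformCircle_congr_ae {f f' : ℝ → ℝ} (h : f =ᵐ[volume] f') (x : ℝ) :
    hilbertTransformCircle f x = hilbertTransformCircle f' x := by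
  haveI : (volume : Measure ℝ).IsNegInvariant := Measure.IsAddHaarMeasure.isNegInvariant_of_regular _
  unfold hilbertTransformCircle
  congr 1
  refine intervalIntegral.integral_congr_ae ?_
  have h1 : ∀ᵐ t : ℝ ∂volume, f (x - t) = f' (x - t) :=
    (Measure.measurePreserving_sub_left (volume : Measure ℝ) x).quasiMeasurePreserving.ae h
  have h2 : ∀ᵐ t : ℝ ∂volume, f (x + t) = f' (x + t) :=
    (measurePreserving_add_left (volume : Measure ℝ) x).quasiMeasurePreserving.ae h
  filter_upwards [h1, h2] with t ht1 ht2 _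
  rw [ht1, ht2]

/-! ### Complex-coefficient form of the termwise rule -/

/-- `e^{iy}^m = cos(my) + i sin(my)`: real part (helper). [folklore] -/
private theorem exp_mul_I_pow_re (y : ℝ) (m : ℕ) :
    (Complex.exp (y * I) ^ m).re = Real.cos ((m : ℝ) * y) := by
  rw [← Complex.exp_nat_mul, show (m : ℂ) * (y * I) = (((m : ℝ) * y : ℝ) : ℂ) * I by push_cast; ring,
    Complex.exp_ofReal_mul_I_re]

/-- `e^{iy}^m = cos(my) + i sin(my)`: imaginary part (helper). [folklore] -/
private theorem exp_mul_I_pow_im (y : ℝ) (m : ℕ) :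
    (Complex.exp (y * I) ^ m).im = Real.sin ((m : ℝ) * y) := by
  rw [← Complex.exp_nat_mul, show (m : ℂ) * (y * I) = (((m : ℝ) * y : ℝ) : ℂ) * I by push_cast; ring,
    Complex.exp_ofReal_mul_I_im]

/-- Real part of one term `a e^{imy}`: `Re a · cos(my) − Im a · sin(my)` (helper). [folklore] -/
private theorem term_re (a : ℂ) (y : ℝ) (m : ℕ) :
    (a * Complex.exp (y * I) ^ m).re = -a.im * Real.sin ((m : ℝ) * y) + a.re * Real.cos ((m : ℝ) * y) := by
  rw [Complex.mul_re, exp_mul_I_pow_re, exp_mul_I_pow_im]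
  ring

/-- Imaginary part of one term `a e^{imy}`: `Re a · sin(my) + Im a · cos(my)` (helper). [folklore] -/
private theorem term_im (a : ℂ) (y : ℝ) (m : ℕ) :
    (a * Complex.exp (y * I) ^ m).im = -(-a.im) * Real.cos ((m : ℝ) * y) + a.re * Real.sin ((m : ℝ) * y) := by
  rw [Complex.mul_im, exp_mul_I_pow_re, exp_mul_I_pow_im]
  ring

/-- Shifting off the constant term: if `Σ_{n ≥ 0} a_n e^{iny} = F(y)` then `Σ_{k ≥ 0} a_{k+1} e^{i(k+1)y} = F(y) − a₀` (helper).
[folklore] -/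
private theorem hasSum_shift {a : ℕ → ℂ} {y : ℝ} {S : ℂ}
    (h : HasSum (fun n : ℕ => a n * Complex.exp (y * I) ^ n) S) :
    HasSum (fun k : ℕ => a (k + 1) * Complex.exp (y * I) ^ (k + 1)) (S - a 0) := by
  have h1 := (hasSum_nat_add_iff' (f := fun n : ℕ => a n * Complex.exp (y * I) ^ n) 1).mpr h
  simpa [Finset.sum_range_one] using h1

/-- **Complex-coefficient form of the termwise rule.** If `F(y) = Σ_{n ≥ 0} a_n e^{iny}` for every real `y`, with a finite first
moment `Σ_n n‖a_n‖ < ∞`, then the periodic Hilbert transform of `Re F` is `Im F − Im a₀`: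
`H[Re F](x) = Im F(x) − Im a₀`. This is `hilbertTransformCircle_tsum` (multiplier `−i·sgn k`) read on an analytic-type series.
[cite: Katznelson2004, Ch. III §1 (conjugate function = multiplier `−i sgn n`)] -/
theorem hilbertTransformCircle_re_of_hasSum {a : ℕ → ℂ} (ha : Summable fun n : ℕ => (n : ℝ) * ‖a n‖)
    {F : ℝ → ℂ} (hF : ∀ y : ℝ, HasSum (fun n : ℕ => a n * Complex.exp (y * I) ^ n) (F y)) (x : ℝ) :
    hilbertTransformCircle (fun y => (F y).re) x = (F x).im - (a 0).im := by
  -- the cosine/sine coefficients of the folded real series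
  set α : ℕ → ℝ := fun k => -(a (k + 1)).im with hα
  set β : ℕ → ℝ := fun k => (a (k + 1)).re with hβ
  -- first-moment summability in the form `hilbertTransformCircle_tsum` wants
  have ha1 : Summable fun k : ℕ => (((k + 1 : ℕ) : ℝ)) * ‖a (k + 1)‖ :=
    (summable_nat_add_iff (f := fun n : ℕ => (n : ℝ) * ‖a n‖) 1).mpr ha
  have hs : Summable fun k : ℕ => ((k : ℝ) + 1) * (|α k| + |β k|) := by
    refine Summable.of_nonneg_of_le (fun k => by positivity) (fun k => ?_) (ha1.mul_left 2)
    have h1 : |α k| ≤ ‖a (k + 1)‖ := by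
      rw [hα]; simp only [abs_neg]; exact Complex.abs_im_le_norm _
    have h2 : |β k| ≤ ‖a (k + 1)‖ := by rw [hβ]; exact Complex.abs_re_le_norm _
    have hk : (0 : ℝ) ≤ (k : ℝ) + 1 := by positivity
    calc ((k : ℝ) + 1) * (|α k| + |β k|) ≤ ((k : ℝ) + 1) * (‖a (k + 1)‖ + ‖a (k + 1)‖) := by gcongr
      _ = 2 * ((((k + 1 : ℕ) : ℝ)) * ‖a (k + 1)‖) := by push_cast; ring
  -- the real part of the series, folded: `Re F(y) = Re a₀ + Σ_k (α_k sin((k+1)y) + β_k cos((k+1)y))`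
  have hre : ∀ y : ℝ, (F y).re = (a 0).re
      + ∑' k : ℕ, (α k * Real.sin (((k + 1 : ℕ) : ℝ) * y) + β k * Real.cos (((k + 1 : ℕ) : ℝ) * y)) := by
    intro y
    have h1 := Complex.hasSum_re (hasSum_shift (hF y))
    simp only [Complex.sub_re] at h1
    have h2 : HasSum (fun k : ℕ => α k * Real.sin (((k + 1 : ℕ) : ℝ) * y) + β k * Real.cos (((k + 1 : ℕ) : ℝ) * y))
        ((F y).re - (a 0).re) := by
      refine h1.congr_fun fun k => ?_
      rw [term_re]
    rw [h2.tsum_eq]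
    ring
  have hfun : (fun y => (F y).re) = fun y => (a 0).re
      + ∑' k : ℕ, (α k * Real.sin (((k + 1 : ℕ) : ℝ) * y) + β k * Real.cos (((k + 1 : ℕ) : ℝ) * y)) :=
    funext hre
  -- constants are invisible to `H`
  have hconst : hilbertTransformCircle (fun y => (a 0).re
      + ∑' k : ℕ, (α k * Real.sin (((k + 1 : ℕ) : ℝ) * y) + β k * Real.cos (((k + 1 : ℕ) : ℝ) * y))) x
      = hilbertTransformCircle (fun y =>
        ∑' k : ℕ, (α k * Real.sin (((k + 1 : ℕ) : ℝ) * y) + β k * Real.cos (((k + 1 : ℕ) : ℝ) * y))) x := by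
    unfold hilbertTransformCircle
    simp only [add_sub_add_left_eq_sub]
  rw [hfun, hconst, hilbertTransformCircle_tsum hs x]
  -- the imaginary part of the series, folded the same way
  have h3 := Complex.hasSum_im (hasSum_shift (hF x))
  simp only [Complex.sub_im] at h3
  have h4 : HasSum (fun k : ℕ => -α k * Real.cos (((k + 1 : ℕ) : ℝ) * x) + β k * Real.sin (((k + 1 : ℕ) : ℝ) * x))
      ((F x).im - (a 0).im) := by
    refine h3.congr_fun fun k => ?_
    rw [term_im]
  exact h4.tsum_eq

/-! ### Holomorphic functions on a neighbourhood of the closed unit disc -/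

/-- Cauchy's estimate gives a finite first moment: for `R > 1` the Taylor coefficients `b_n` of `TaylorOnClosedDisc.lean` satisfy
`Σ_n n‖b_n‖ < ∞` (`n‖b_n‖ ≤ C n R^{−n}`) (helper). [folklore] -/
private theorem summable_mul_norm_taylorCoeff (g : ℂ → ℂ) {R : ℝ} (hR : 1 < R) :
    Summable fun n : ℕ => (n : ℝ) * ‖taylorCoeff g R n‖ := by
  set C : ℝ := (2 * π)⁻¹ * ∫ θ : ℝ in (0 : ℝ)..2 * π, ‖g (circleMap 0 R θ)‖ with hC
  have hC0 : 0 ≤ C := mul_nonneg (inv_nonneg.mpr (by positivity))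
    (intervalIntegral.integral_nonneg (by positivity) fun _ _ => norm_nonneg _)
  have hr0 : 0 ≤ |R|⁻¹ := by positivity
  have hr1 : ‖|R|⁻¹‖ < 1 := by
    rw [Real.norm_eq_abs, abs_of_nonneg hr0, abs_of_pos (by linarith)]
    exact inv_lt_one_of_one_lt₀ hR
  have hgeo : Summable fun n : ℕ => ((n : ℝ) ^ 1 * |R|⁻¹ ^ n : ℝ) :=
    summable_pow_mul_geometric_of_norm_lt_one 1 hr1
  refine Summable.of_nonneg_of_le (fun n => by positivity) (fun n => ?_) (hgeo.mul_left C)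
  calc (n : ℝ) * ‖taylorCoeff g R n‖ ≤ (n : ℝ) * (C * |R|⁻¹ ^ n) := by
        gcongr
        exact norm_taylorCoeff_le g R n
    _ = C * ((n : ℝ) ^ 1 * |R|⁻¹ ^ n) := by ring

/-- The zeroth Taylor coefficient is the value at the centre: `b₀ = g(0)` (from the expansion at `z = 0`) (helper). [folklore] -/
private theorem taylorCoeff_zero_eq {g : ℂ → ℂ} {R : ℝ≥0} (hR : 0 < R) (hg : DifferentiableOn ℂ g (closedBall 0 R)) :
    taylorCoeff g R 0 = g 0 := by
  have h0 : ‖(0 : ℂ)‖ < R := by simpa using hR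
  have h1 : HasSum (fun n => taylorCoeff g R n * (0 : ℂ) ^ n) (g 0) := hasSum_taylorCoeff hR hg h0
  have h2 : HasSum (fun n => taylorCoeff g R n * (0 : ℂ) ^ n) (taylorCoeff g R 0 * (0 : ℂ) ^ 0) :=
    hasSum_single 0 fun n hn => by simp [hn]
  have h3 := h1.unique h2
  simpa using h3.symm

/-- An open neighbourhood of the closed unit disc contains a closed disc of radius `R > 1` (compactness) (helper). [folklore] -/
private theorem exists_closedBall_subset_of_isOpen {U : Set ℂ} (hU : IsOpen U) (hsub : closedBall (0 : ℂ) 1 ⊆ U) :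
    ∃ R : ℝ≥0, 1 < R ∧ closedBall (0 : ℂ) R ⊆ U := by
  obtain ⟨δ, hδ, hδU⟩ := (isCompact_closedBall (0 : ℂ) 1).exists_cthickening_subset_open hU hsub
  refine ⟨⟨δ + 1, by positivity⟩, ?_, ?_⟩
  · change (1 : ℝ) < δ + 1
    linarith
  · have h := cthickening_closedBall hδ.le zero_le_one (0 : ℂ)
    rw [h] at hδU
    exact hδU

/-- **The conjugate function of the boundary values of a holomorphic function.** If `g` is holomorphic on an open
neighbourhood `U` of the closed unit disc, then for every real `x`
`H[y ↦ Re g(e^{iy})](x) = Im g(e^{ix}) − Im g(0)` — the periodic Hilbert transform (p.v. `cot` kernel, `H cos = sin`) of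
`Re g|_{𝕋}` is `Im g|_{𝕋}` minus its mean. Proof: Taylor expansion on a disc of radius `R > 1` (`TaylorOnClosedDisc.lean`), Cauchy's
estimate for the first moment, and the termwise rule. [cite: Katznelson2004, Ch. III §1 (conjugate function of `Re F`, `F` analytic
in a neighbourhood of the closed disc, is `Im F − Im F(0)`)] -/
theorem hilbertTransformCircle_re_eq_im {g : ℂ → ℂ} {U : Set ℂ} (hU : IsOpen U)
    (hsub : closedBall (0 : ℂ) 1 ⊆ U) (hg : DifferentiableOn ℂ g U) (x : ℝ) :
    hilbertTransformCircle (fun y : ℝ => (g (Complex.exp (y * I))).re) x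
      = (g (Complex.exp (x * I))).im - (g 0).im := by
  obtain ⟨R, hR, hRU⟩ := exists_closedBall_subset_of_isOpen hU hsub
  have hR0 : 0 < R := lt_trans zero_lt_one hR
  have hgR : DifferentiableOn ℂ g (closedBall 0 R) := hg.mono hRU
  have hF : ∀ y : ℝ, HasSum (fun n : ℕ => taylorCoeff g R n * Complex.exp (y * I) ^ n)
      (g (Complex.exp (y * I))) := by
    intro y
    have hz : ‖Complex.exp (y * I)‖ < (R : ℝ) := by
      rw [Complex.norm_exp_ofReal_mul_I]
      exact_mod_cast hR
    exact hasSum_taylorCoeff hR0 hgR hz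
  have hR' : (1 : ℝ) < (R : ℝ) := by exact_mod_cast hR
  rw [hilbertTransformCircle_re_of_hasSum (summable_mul_norm_taylorCoeff g hR') hF x,
    taylorCoeff_zero_eq hR0 hgR]

/-- The same, as an identity of functions on `ℝ`. [cite: Katznelson2004, Ch. III §1] -/
theorem hilbertTransformCircle_re_eq_im_fun {g : ℂ → ℂ} {U : Set ℂ} (hU : IsOpen U)
    (hsub : closedBall (0 : ℂ) 1 ⊆ U) (hg : DifferentiableOn ℂ g U) :
    hilbertTransformCircle (fun y : ℝ => (g (Complex.exp (y * I))).re)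
      = fun x : ℝ => (g (Complex.exp (x * I))).im - (g 0).im :=
  funext fun x => hilbertTransformCircle_re_eq_im hU hsub hg x

/-- Entire functions (in particular polynomials): `H[y ↦ Re g(e^{iy})](x) = Im g(e^{ix}) − Im g(0)` for `g` complex-differentiable
on `ℂ`. [cite: Katznelson2004, Ch. III §1] -/
theorem hilbertTransformCircle_re_eq_im_of_differentiable {g : ℂ → ℂ} (hg : Differentiable ℂ g) (x : ℝ) :
    hilbertTransformCircle (fun y : ℝ => (g (Complex.exp (y * I))).re) x
      = (g (Complex.exp (x * I))).im - (g 0).im :=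
  hilbertTransformCircle_re_eq_im isOpen_univ (subset_univ _) hg.differentiableOn x

end Literature.Analysis.Fourier
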